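import Literature.Geometry.Riemannian.GradientShrinker
import Literature.Geometry.Riemannian.PerelmanEntropyCutoff
import Literature.Geometry.Riemannian.ModelTransportMetric
import Literature.Geometry.Lorentzian.DalembertianNaturality
import Literature.Geometry.Lorentzian.DalembertianCompose
import HarnessLib

/-!
# Carrillo–Ni 2009, Cor. 4.1 on a closed gradient shrinker: the proved layer
# (`μ(g, 1) ≤ log Θ` unconditionally; `log Θ ≤ μ(g, 1)` from the Bakry–Émery inequality)

Sibling proof file of `GradientShrinker.lean`, whose named fact
`carrilloNi_muEntropy_eq_log_shrinkerDensity` (J. A. Carrillo, L. Ni, *Sharp logarithmic Sobolev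
inequalities on gradient solitons and applications*, Comm. Anal. Geom. 17 (2009) 721–753 =
arXiv:0806.2417, Cor. 4.1, closed case, in the tree's normalisation `R + |∇f|² = f`) reads: on a
closed connected Riemannian manifold (any model space `E`) with `Ric + Hess f = g/2`,
`R + |∇f|² = f`, Perelman's `μ(g, 1)` equals `log Θ`, `Θ = (4π)^{-n/2} ∫ e^{-f} dV`. Everything
in this file is PROVED; no definition and no statement of `Prop` type is introduced (D-0026).

## The printed proof (arXiv text, §2 p. 5, §3 Thm. 3.1 p. 7, §4 p. 9) and what is here

* §2, (2.1)–(2.3): `S + Δf = n/2τ` (trace of the soliton equation), `S + |∇f|² − f/τ = μ_s/τ`,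
  hence `2Δf − |∇f|² + S + (f − n)/τ = −μ_s/τ`. PROVED for any model (`§ Pointwise`):
  `IsGradientShrinker.scalarCurvature_add_dalembertian`,
  `IsNormalisedShrinker.two_mul_dalembertian_identity` (the tree's normalisation is `μ_s = 0`
  for `f`, i.e. `μ_s = −log Θ` for the unit-mass shift `f + log Θ`), and
  `IsNormalisedShrinker.dalembertian_exp_neg`: `Δ(e^{-f}) = (f − n/2) e^{-f}`.
* §4, sharpness ("`u = e^{-f}/(4πτ)^{n/2}` is the minimizer for Perelman's `μ(g, τ)`"): with
  `Θ = (4π)^{-n/2}∫ e^{-f} dV` the shift `f + log Θ` is compatible and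
  `𝒲(g, f + log Θ, 1) = log Θ + Θ⁻¹(4π)^{-n/2} ∫ (2f − n) e^{-f} dV = log Θ`, the last integral
  being `2 ∫ Δ(e^{-f}) dV = 0` by Green. PROVED for any model (`§ Sharpness`, `§ Green`):
  the tree's Green identities (`GreenIdentity.lean`, stated for manifolds modelled on
  `EuclideanSpace ℝ (Fin m)`) are moved to an arbitrary finite-dimensional model `E` by
  transporting the metric to the Euclidean-model structure of the same manifold
  (`ModelTransportMetric.lean`: `transportCLE`, `riemVolume_transportCLE`; here
  `dalembertian_transportCLE`, `innerDual_mvfderiv_transportCLE`), giving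
  `integral_dalembertian_riemVolume_eq_zero` and `integral_mul_dalembertian_riemVolume` for every
  closed Riemannian manifold of the tree, whence **`μ(g, 1) ≤ log Θ` unconditionally**
  (`IsNormalisedShrinker.muEntropy_le_log_shrinkerDensity`).
* §4, the inequality: Carrillo–Ni apply the Bakry–Émery logarithmic Sobolev inequality
  (their Thm. 3.1, quoted from Villani, *Optimal transport, old and new*, via the HWI
  inequality; originally D. Bakry, M. Émery, *Diffusions hypercontractives*, LNM 1123 (1985)):
  for the probability measure `dm = e^{-V} dV`, `V = f + log Θ + (n/2) log 4π`, which satisfies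
  `Ric + Hess V = g/2` (`C(1/2, ∞)`), `H_V(ρ) ≤ I_V(ρ)`; then (p. 9)
  `I_V(ρ) = ∫ (|∇ψ|²ρ + 2⟨∇f, ∇ρ⟩ + |∇f|²ρ) = ∫ (|∇ψ|² − 2Δf + |∇f|²)ρ = ∫ (|∇ψ|² + S + f + μ_s − n)ρ`
  and `H_V(ρ) = ∫ (f − ψ)ρ`, so that `𝒲(g, ψ, 1) ≥ −μ_s`. PROVED here as a REDUCTION
  (`§ LSI`): `IsNormalisedShrinker.log_shrinkerDensity_le_muEntropy_of_logSobolev` derives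
  `log Θ ≤ μ(g, 1)` from the Bakry–Émery inequality for `m` taken as an explicit hypothesis (in
  the smooth form `∫ φ e^φ dm ≤ ∫ |∇φ|² e^φ dm` for smooth `φ` with `∫ e^φ dm = 1`), by exactly
  this computation (Green's first identity `∫ u Δf = −∫ g⁻¹(du, df)` for the cross term), and
  `carrilloNi_muEntropy_eq_log_shrinkerDensity_of_bakryEmery` assembles the named fact from the
  Bakry–Émery theorem on closed weighted manifolds (`Ric + Hess V ≥ K g`, `K > 0`).
  The Bakry–Émery theorem itself (heat-semigroup / optimal-transport analysis on a closed
  manifold) is NOT in the tree; it is the one remaining input of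
  `carrilloNi_muEntropy_eq_log_shrinkerDensity_holds`.

## References

* [CarrilloNi2009] J. A. Carrillo, L. Ni, Comm. Anal. Geom. 17 (2009) 721–753
  (arXiv:0806.2417): §2 (2.1)–(2.3), Thm. 3.1, §4, Cor. 4.1 (read: arXiv text pp. 5, 7, 9).
* D. Bakry, M. Émery, *Diffusions hypercontractives*, Sém. Probab. XIX, LNM 1123 (1985)
  177–206 (the `Γ₂` criterion). [BakryEmery1985]
* [Lee2018] J. M. Lee, *Introduction to Riemannian Manifolds*, 2nd ed. (2018), Problem 2-23
  (Green's identities on a closed manifold).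
-/

noncomputable section

open Bundle Set Function Module Filter MeasureTheory Manifold
open scoped ContDiff Topology ENNReal NNReal

namespace Literature.Geometry.Riemannian

open Lorentzian Lorentzian.PseudoRiemannianMetric

universe u

/-! ### §2 (2.1)–(2.3): pointwise identities of a gradient shrinker (any model) -/

section Pointwise

variable {E : Type*} [NormedAddCommGroup E] [NormedSpace ℝ E] [FiniteDimensional ℝ E]
  {H : Type*} [TopologicalSpace H] {I : ModelWithCorners ℝ E H} {M : Type*} [TopologicalSpace M]
  [ChartedSpace H M] [IsManifold I ∞ M]
  {g : PseudoRiemannianMetric I ∞ E (TangentSpace I : M → Type _)} {f : M → ℝ} {τ : ℝ}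

/-- `|∇(f + c)|² = |∇f|²` at a point of differentiability (chain rule with `t ↦ t + c`).
[folklore] -/
theorem _root_.Literature.Geometry.Lorentzian.PseudoRiemannianMetric.gradSq_add_const
    (g : PseudoRiemannianMetric I ∞ E (TangentSpace I : M → Type _)) (c : ℝ) {x : M}
    (hfx : MDifferentiableAt I 𝓘(ℝ, ℝ) f x) :
    g.gradSq (fun y ↦ f y + c) x = g.gradSq f x := by
  have hh : HasDerivAt (fun t : ℝ ↦ t + c) 1 (f x) := (hasDerivAt_id (f x)).add_const c
  have := g.gradSq_real_comp (h := fun t : ℝ ↦ t + c) hh hfx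
  rw [show (fun y ↦ f y + c) = (fun t : ℝ ↦ t + c) ∘ f from rfl, this, one_pow, one_mul]

variable [g.HasLeviCivita]

/-- **(2.1): `S + Δf = n/(2τ)`** on a gradient shrinking soliton `Ric + Hess f = g/(2τ)` — the
metric trace of the soliton equation (`tr_g Ric = S`, `tr_g Hess f = Δf`, `tr_g g = n`).
[cite: CarrilloNi2009, §2, (2.1)] -/
theorem _root_.Literature.Geometry.Lorentzian.PseudoRiemannianMetric.IsGradientShrinker.scalarCurvature_add_dalembertian
    (h : g.IsGradientShrinker f τ) (x : M) :
    g.scalarCurvature x + g.dalembertian f x = (finrank ℝ E : ℝ) * (1 / (2 * τ)) := by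
  have hform : g.ricci x + g.hessian f x = (1 / (2 * τ)) • g.toBilinForm x := by
    refine LinearMap.ext₂ fun X Y ↦ ?_
    simpa using h x X Y
  have htr := congrArg (g.trace x) hform
  rw [trace_add, trace_smul, trace_toBilinForm_eq] at htr
  rw [PseudoRiemannianMetric.scalarCurvature, PseudoRiemannianMetric.dalembertian, htr]
  ring

/-- **(2.1) at `τ = 1`: `S + Δf = n/2`.** [cite: CarrilloNi2009, §2, (2.1)] -/
theorem _root_.Literature.Geometry.Lorentzian.PseudoRiemannianMetric.IsGradientShrinker.scalarCurvature_add_dalembertian_one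
    (h : g.IsGradientShrinker f 1) (x : M) :
    g.scalarCurvature x + g.dalembertian f x = (finrank ℝ E : ℝ) / 2 := by
  rw [h.scalarCurvature_add_dalembertian x]
  ring

/-- **(2.3) with `μ_s = 0`: `2Δf − |∇f|² + S + f − n = 0`** for a gradient shrinker normalised by
`S + |∇f|² = f` (the tree's normalisation = (2.2) at `τ = 1` with `μ_s(1) = 0`), from (2.1).
[cite: CarrilloNi2009, §2, (2.2)–(2.3)] -/
theorem _root_.Literature.Geometry.Lorentzian.PseudoRiemannianMetric.IsNormalisedShrinker.two_mul_dalembertian_identity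
    (h : g.IsNormalisedShrinker f 1) (x : M) :
    2 * g.dalembertian f x - g.gradSq f x + g.scalarCurvature x + f x - finrank ℝ E = 0 := by
  have h1 := h.1.scalarCurvature_add_dalembertian_one x
  have h2 := h.2 x
  rw [div_one] at h2
  linarith

/-- **`Δ(e^{-f}) = (f − n/2) e^{-f}`** on a gradient shrinker normalised by `S + |∇f|² = f`
(`τ = 1`): `Δ(e^{-f}) = (|∇f|² − Δf) e^{-f}` (`dalembertian_real_comp`) and
`|∇f|² − Δf = (f − S) − (n/2 − S)` by (2.1)–(2.2). The sharpness clause of §4 is the vanishing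
of `∫ Δ(e^{-f}) dV`. [cite: CarrilloNi2009, §2 (2.1)–(2.3) and §4] -/
theorem _root_.Literature.Geometry.Lorentzian.PseudoRiemannianMetric.IsNormalisedShrinker.dalembertian_exp_neg
    (h : g.IsNormalisedShrinker f 1) (hf : ContMDiff I 𝓘(ℝ, ℝ) ∞ f) (x : M) :
    g.dalembertian (fun y ↦ Real.exp (-f y)) x =
      (f x - (finrank ℝ E : ℝ) / 2) * Real.exp (-f x) := by
  have hfx : ContMDiffAt I 𝓘(ℝ, ℝ) 2 f x := (hf.of_le ENat.LEInfty.out).contMDiffAt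
  have hζ : ContDiffAt ℝ 2 (fun t : ℝ ↦ Real.exp (-t)) (f x) :=
    (Real.contDiff_exp.comp contDiff_neg).contDiffAt
  have hd : ∀ t : ℝ, HasDerivAt (fun s : ℝ ↦ Real.exp (-s)) (-Real.exp (-t)) t := fun t ↦ by
    simpa using (hasDerivAt_neg t).exp
  have hd1 : deriv (fun s : ℝ ↦ Real.exp (-s)) = fun t ↦ -Real.exp (-t) :=
    funext fun t ↦ (hd t).deriv
  have hd2 : deriv (deriv fun s : ℝ ↦ Real.exp (-s)) (f x) = Real.exp (-f x) := by
    rw [hd1]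
    simpa using (hd (f x)).neg.deriv
  have hcomp := g.dalembertian_real_comp (ζ := fun t : ℝ ↦ Real.exp (-t)) hfx hζ
  rw [show (fun y ↦ Real.exp (-f y)) = (fun t : ℝ ↦ Real.exp (-t)) ∘ f from rfl, hcomp, hd2,
    (hd (f x)).deriv]
  have hgrad : g.innerDual x (mvfderiv I f x).toLinearMap (mvfderiv I f x).toLinearMap =
      g.gradSq f x := rfl
  rw [hgrad]
  have h1 := h.1.scalarCurvature_add_dalembertian_one x
  have h2 := h.2 x
  rw [div_one] at h2
  have h3 : g.gradSq f x - g.dalembertian f x = f x - finrank ℝ E / 2 := by linarith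
  rw [← h3]
  ring

/-- The Hessian of `f + c` is the Hessian of `f` (for `f` of class `C²` at the point): chain rule
`hessian_real_comp` with `ζ(t) = t + c`, `ζ' = 1`, `ζ'' = 0`. [folklore] -/
theorem _root_.Literature.Geometry.Lorentzian.PseudoRiemannianMetric.hessian_add_const
    (g : PseudoRiemannianMetric I ∞ E (TangentSpace I : M → Type _)) [g.HasLeviCivita] (c : ℝ)
    {u : M → ℝ} {x : M} (hu : ContMDiffAt I 𝓘(ℝ, ℝ) 2 u x) (v w : TangentSpace I x) :
    g.hessian (fun y ↦ u y + c) x v w = g.hessian u x v w := by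
  have hζ : ContDiffAt ℝ 2 (fun t : ℝ ↦ t + c) (u x) := (contDiff_id.add contDiff_const).contDiffAt
  have hd1 : deriv (fun t : ℝ ↦ t + c) = fun _ ↦ 1 := by
    funext t
    simp
  have hd2 : deriv (deriv fun t : ℝ ↦ t + c) (u x) = 0 := by
    rw [hd1, deriv_const]
  have h := g.hessian_real_comp (ζ := fun t : ℝ ↦ t + c) hu hζ v w
  rw [show (fun y ↦ u y + c) = (fun t : ℝ ↦ t + c) ∘ u from rfl, h, hd2, hd1]
  ring

end Pointwise

/-! ### The density `Θ` as a real number; the unit-mass shift `f + log Θ` -/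

section Theta

variable {E : Type*} [NormedAddCommGroup E] [NormedSpace ℝ E] [FiniteDimensional ℝ E]
  {H : Type*} [TopologicalSpace H] {I : ModelWithCorners ℝ E H} {M : Type*} [TopologicalSpace M]
  [ChartedSpace H M] [IsManifold I ∞ M] [T3Space M] [MeasurableSpace M] [BorelSpace M]
  {g : PseudoRiemannianMetric I ∞ E (TangentSpace I : M → Type _)} {f : M → ℝ}

/-- **`Θ` as a real number**: for an integrable potential and `τ > 0`,
`Θ.toReal = (4πτ)^{-n/2} ∫_M e^{-f} dV` (the `lintegral` of the nonnegative integrand is the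
Bochner integral). [cite: CaoHamiltonIlmanen2004, §3] -/
theorem _root_.Literature.Geometry.Lorentzian.PseudoRiemannianMetric.shrinkerDensity_toReal
    (g : PseudoRiemannianMetric I ∞ E (TangentSpace I : M → Type _))
    (hint : Integrable (fun x ↦ Real.exp (-f x)) g.riemVolume) {τ : ℝ} (hτ : 0 < τ) :
    (g.shrinkerDensity f τ).toReal =
      (4 * Real.pi * τ) ^ (-(finrank ℝ E : ℝ) / 2) * ∫ x, Real.exp (-f x) ∂g.riemVolume := by
  rw [PseudoRiemannianMetric.shrinkerDensity, ENNReal.toReal_mul,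
    ENNReal.toReal_ofReal (entropyNormalisation_pos _ hτ).le,
    integral_eq_lintegral_of_nonneg_ae (Eventually.of_forall fun x ↦ (Real.exp_pos _).le)
      hint.aestronglyMeasurable]

/-- **`(4πτ)^{-n/2} ∫_M e^{-f} dV > 0`** for an integrable potential on a nonempty Riemannian
manifold (`e^{-f} > 0` and `Vol(M) > 0`, `riemVolume_univ_pos`). [folklore] -/
theorem thetaReal_pos [I.Boundaryless] [Nonempty M] (hg : g.IsRiemannian)
    (hint : Integrable (fun x ↦ Real.exp (-f x)) g.riemVolume) {τ : ℝ} (hτ : 0 < τ) :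
    0 < (4 * Real.pi * τ) ^ (-(finrank ℝ E : ℝ) / 2) * ∫ x, Real.exp (-f x) ∂g.riemVolume := by
  haveI : NeZero g.riemVolume := ⟨fun h0 ↦ by
    have hpos := PseudoRiemannianMetric.riemVolume_univ_pos (I := I) (M := M) hg
    rw [h0] at hpos
    simp at hpos⟩
  exact mul_pos (entropyNormalisation_pos _ hτ) (integral_exp_pos hint)

/-- **`Θ > 0` as a real number** on a nonempty Riemannian manifold with integrable potential.
[folklore] -/
theorem _root_.Literature.Geometry.Lorentzian.PseudoRiemannianMetric.shrinkerDensity_toReal_pos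
    [I.Boundaryless] [Nonempty M] (hg : g.IsRiemannian)
    (hint : Integrable (fun x ↦ Real.exp (-f x)) g.riemVolume) {τ : ℝ} (hτ : 0 < τ) :
    0 < (g.shrinkerDensity f τ).toReal := by
  rw [g.shrinkerDensity_toReal hint hτ]
  exact thetaReal_pos hg hint hτ

omit [TopologicalSpace M] [T3Space M] [MeasurableSpace M] [BorelSpace M] in
/-- The density of the shifted potential at `τ = 1`:
`(4π)^{-n/2} e^{-(f + log Θ)} = Θ⁻¹ · (4π)^{-n/2} e^{-f}` (`Θ > 0`). [folklore] -/
theorem entropyDensity_add_log_of_pos {Θ : ℝ} (hΘ : 0 < Θ) (n : ℕ) (x : M) :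
    entropyDensity n (fun y ↦ f y + Real.log Θ) 1 x =
      Θ⁻¹ * ((4 * Real.pi) ^ (-(n : ℝ) / 2) * Real.exp (-f x)) := by
  rw [entropyDensity_apply, mul_one, neg_add, Real.exp_add, Real.exp_neg (Real.log _),
    Real.exp_log hΘ]
  ring

/-- **Thm. 1.1 (i), normalisation** ("it can be normalized"): with
`Θ = (4π)^{-n/2} ∫ e^{-f} dV` (real form of the shrinker density) the shift `f + log Θ` is
compatible at `τ = 1`: `∫ (4π)^{-n/2} e^{-(f + log Θ)} dV = 1`. [cite: CarrilloNi2009, Thm. 1.1 (i)] -/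
theorem isEntropyCompatible_add_log_shrinkerDensity [I.Boundaryless] [Nonempty M]
    (hg : g.IsRiemannian) (hint : Integrable (fun x ↦ Real.exp (-f x)) g.riemVolume) :
    g.IsEntropyCompatible (fun y ↦ f y + Real.log (g.shrinkerDensity f 1).toReal) 1 := by
  have hΘ := g.shrinkerDensity_toReal_pos hg hint one_pos
  rw [PseudoRiemannianMetric.isEntropyCompatible_iff]
  simp_rw [entropyDensity_add_log_of_pos hΘ]
  rw [integral_const_mul, integral_const_mul, g.shrinkerDensity_toReal hint one_pos, mul_one,
    inv_mul_cancel₀]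
  rw [← mul_one (4 * Real.pi), ← g.shrinkerDensity_toReal hint one_pos]
  · exact hΘ.ne'

end Theta

/-! ### Transport of `g⁻¹(du, dv)` and of `Δ_g` to the Euclidean-model structure -/

section Transport

variable {E : Type*} [NormedAddCommGroup E] [NormedSpace ℝ E] [FiniteDimensional ℝ E]
  {E' : Type*} [NormedAddCommGroup E'] [NormedSpace ℝ E'] [FiniteDimensional ℝ E']
  {H : Type*} [TopologicalSpace H] {I : ModelWithCorners ℝ E H}
  {M : Type*} [TopologicalSpace M] [ChartedSpace H M] [IsManifold I ∞ M]
  (g : PseudoRiemannianMetric I ∞ E (TangentSpace I : M → Type _)) (e : E ≃L[ℝ] E')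

omit [FiniteDimensional ℝ E] [FiniteDimensional ℝ E'] [IsManifold I ∞ M] in
/-- Transporting a boundaryless model along a linear isomorphism of the model vector space gives
a boundaryless model (`range (e ∘ I) = e(E) = E'`). A theorem, not an instance; use `haveI`.
[folklore] -/
theorem boundaryless_transCLE (I : ModelWithCorners ℝ E H) (e : E ≃L[ℝ] E') [I.Boundaryless] :
    (I.transContinuousLinearEquiv e).Boundaryless :=
  ⟨by rw [ModelWithCorners.transContinuousLinearEquiv_range, I.range_eq_univ, image_univ,
    e.surjective.range_eq]⟩

omit [FiniteDimensional ℝ E] [FiniteDimensional ℝ E'] [IsManifold I ∞ M] in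
/-- **The differential of a function for the transported model**: `d ψ_x (w) = d ψ_x (e⁻¹ w)`
(`mfderiv_transCLE_left`). [cite: Lee2013, Ch. 3, Prop. 3.6] -/
theorem mvfderiv_transCLE_apply (ψ : M → ℝ) (x : M) (w : E') :
    mvfderiv (I.transContinuousLinearEquiv e) ψ x w = mvfderiv I ψ x (e.symm w) := by
  simp only [mvfderiv, ContinuousLinearMap.comp_apply, mfderiv_transCLE_left_apply]

omit [FiniteDimensional ℝ E] [FiniteDimensional ℝ E'] [IsManifold I ∞ M] in
/-- The differential for the transported model, as a linear map: `dψ ∘ e⁻¹`. [folklore] -/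
theorem mvfderiv_transCLE_toLinearMap (ψ : M → ℝ) (x : M) :
    ((mvfderiv (I.transContinuousLinearEquiv e) ψ x :
        TangentSpace (I.transContinuousLinearEquiv e) x →L[ℝ] ℝ) :
        TangentSpace (I.transContinuousLinearEquiv e) x →ₗ[ℝ] ℝ) =
      (mvfderiv I ψ x : TangentSpace I x →ₗ[ℝ] ℝ) ∘ₗ ((e.symm : E' →L[ℝ] E) : E' →ₗ[ℝ] E) := by
  ext w
  exact mvfderiv_transCLE_apply e ψ x w

/-- **`♯` of the transported metric**: `♯'(β ∘ e⁻¹) = e (♯ β)` (both have the same products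
with every vector). [cite: ONeill1983, Ch. 3, p. 60] -/
theorem sharp_transportCLE (x : M) (β : Module.Dual ℝ (TangentSpace I x)) :
    (g.transportCLE e).sharp x (β ∘ₗ ((e.symm : E' →L[ℝ] E) : E' →ₗ[ℝ] E)) =
      e (g.sharp x β) := by
  apply (g.transportCLE e).flat_injective x
  rw [flat_sharp]
  ext w
  rw [flat_apply, transportCLE_val_apply, LinearMap.comp_apply]
  change β (e.symm w) = g.val x (e.symm (e (g.sharp x β))) (e.symm w)
  rw [e.symm_apply_apply, val_sharp_apply]

/-- **The inverse metric on covectors is unchanged by the transport**: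
`(g')⁻¹(α ∘ e⁻¹, β ∘ e⁻¹) = g⁻¹(α, β)`. [cite: ONeill1983, Ch. 3, Prop. 3.59] -/
theorem innerDual_transportCLE (x : M) (α β : Module.Dual ℝ (TangentSpace I x)) :
    (g.transportCLE e).innerDual x (α ∘ₗ ((e.symm : E' →L[ℝ] E) : E' →ₗ[ℝ] E))
        (β ∘ₗ ((e.symm : E' →L[ℝ] E) : E' →ₗ[ℝ] E)) = g.innerDual x α β := by
  rw [PseudoRiemannianMetric.innerDual, sharp_transportCLE, LinearMap.comp_apply,
    PseudoRiemannianMetric.innerDual]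
  change α (e.symm (e (g.sharp x β))) = α (g.sharp x β)
  rw [e.symm_apply_apply]

/-- **`g⁻¹(du, dv)` is unchanged by the transport** (the differentials acquire the factor `e⁻¹`,
the inverse metric absorbs it). [cite: ONeill1983, Ch. 3, Prop. 3.59] -/
theorem innerDual_mvfderiv_transportCLE (u v : M → ℝ) (x : M) :
    (g.transportCLE e).innerDual x
        (mvfderiv (I.transContinuousLinearEquiv e) u x :
          TangentSpace (I.transContinuousLinearEquiv e) x →ₗ[ℝ] ℝ)
        (mvfderiv (I.transContinuousLinearEquiv e) v x :
          TangentSpace (I.transContinuousLinearEquiv e) x →ₗ[ℝ] ℝ) =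
      g.innerDual x (mvfderiv I u x : TangentSpace I x →ₗ[ℝ] ℝ)
        (mvfderiv I v x : TangentSpace I x →ₗ[ℝ] ℝ) := by
  rw [mvfderiv_transCLE_toLinearMap, mvfderiv_transCLE_toLinearMap]
  exact innerDual_transportCLE g e x _ _

/-- **The gradient square is unchanged by the transport**: `|∇ψ|²_{g'} = |∇ψ|²_g`. [folklore] -/
theorem gradSq_transportCLE (ψ : M → ℝ) (x : M) :
    (g.transportCLE e).gradSq ψ x = g.gradSq ψ x :=
  innerDual_mvfderiv_transportCLE g e ψ ψ x

/-- **The Laplace–Beltrami operator is unchanged by the transport**: `Δ_{g'} u (x) = Δ_g u (x)`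
for `u` of class `C²` at `x` (naturality of `Δ` under the local isometry `id`,
`dalembertian_comap`). [cite: ONeill1983, Ch. 3, Prop. 3.59] -/
theorem dalembertian_transportCLE [g.HasLeviCivita] [(g.transportCLE e).HasLeviCivita]
    {u : M → ℝ} {x : M} (hu : ContMDiffAt I 𝓘(ℝ, ℝ) 2 u x) :
    (g.transportCLE e).dalembertian u x = g.dalembertian u x := by
  haveI : CompleteSpace E := FiniteDimensional.complete ℝ E
  haveI : CompleteSpace E' := FiniteDimensional.complete ℝ E'
  haveI : (g.comap (I' := I.transContinuousLinearEquiv e) contMDiff_pullbackBilin_holds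
      (id : M → M) (contMDiff_id_transCLE I e) (injective_mfderiv_id_transCLE I e)
      (finrank_eq_of_cle e)).HasLeviCivita := ‹(g.transportCLE e).HasLeviCivita›
  exact g.dalembertian_comap (I' := I.transContinuousLinearEquiv e) contMDiff_pullbackBilin_holds
    (contMDiff_id_transCLE I e) (injective_mfderiv_id_transCLE I e) (finrank_eq_of_cle e)
    (u := x) (f := u) hu

end Transport

/-! ### Green's identities on a closed Riemannian manifold with an arbitrary model space -/

section Green

variable {E : Type*} [NormedAddCommGroup E] [NormedSpace ℝ E] [FiniteDimensional ℝ E]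
  {H : Type*} [TopologicalSpace H] {I : ModelWithCorners ℝ E H} [I.Boundaryless]
  {M : Type*} [TopologicalSpace M] [ChartedSpace H M] [IsManifold I ∞ M]
  [CompactSpace M] [T3Space M] [MeasurableSpace M] [BorelSpace M]
  (g : PseudoRiemannianMetric I ∞ E (TangentSpace I : M → Type _)) [g.HasLeviCivita]

/-- **`∫_M Δ_g u dV_g = 0` on a closed Riemannian manifold, any model space** (`u ∈ C²`).
The tree's `integral_dalembertian_eq_zero` (`GreenIdentity.lean`, manifolds modelled on
`EuclideanSpace ℝ (Fin m)`) applied to the transported metric `g' = g.transportCLE e`,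
`e : E ≃L ℝ^{dim E}`, on the Euclidean-model structure of the same manifold: `Δ_{g'} u = Δ_g u`
(`dalembertian_transportCLE`) and `dV_{g'} = dV_g` (`riemVolume_transportCLE`).
[cite: Lee2018, Problem 2-23 (c)] -/
theorem integral_dalembertian_riemVolume_eq_zero (hg : g.IsRiemannian) {u : M → ℝ}
    (hu : ContMDiff I 𝓘(ℝ, ℝ) 2 u) : ∫ x, g.dalembertian u x ∂g.riemVolume = 0 := by
  set e : E ≃L[ℝ] EuclideanSpace ℝ (Fin (finrank ℝ E)) := toEuclidean with he
  haveI hB : (I.transContinuousLinearEquiv e).Boundaryless := boundaryless_transCLE I e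
  haveI := (g.transportCLE e).hasLeviCivita
  have hg' : (g.transportCLE e).IsRiemannian := isRiemannian_transportCLE e hg
  have hu' : ContMDiff (I.transContinuousLinearEquiv e) 𝓘(ℝ, ℝ) 2 u :=
    (ContinuousLinearEquiv.contMDiff_transContinuousLinearEquiv_left e).2 hu
  have hΔ : ∀ x, (g.transportCLE e).dalembertian u x = g.dalembertian u x := fun x ↦
    dalembertian_transportCLE g e (hu x)
  have hV : (g.transportCLE e).riemVolume = g.riemVolume := riemVolume_transportCLE e hg
  haveI := (PseudoRiemannianMetric.ofRiemannian
    ((g.transportCLE e).toContMDiffRiemannianMetric hg')).hasLeviCivita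
  have h0 := integral_dalembertian_eq_zero ((g.transportCLE e).toContMDiffRiemannianMetric hg') hu'
  rw [← PseudoRiemannianMetric.riemVolume_eq hg'] at h0
  calc ∫ x, g.dalembertian u x ∂g.riemVolume
      = ∫ x, (g.transportCLE e).dalembertian u x ∂(g.transportCLE e).riemVolume := by
        rw [hV]
        exact integral_congr_ae (Eventually.of_forall fun x ↦ (hΔ x).symm)
    _ = 0 := h0

/-- **Green's first identity on a closed Riemannian manifold, any model space**:
`∫_M u Δ_g f dV_g = −∫_M g⁻¹(du, df) dV_g` for `u ∈ C¹`, `f ∈ C²` — the tree's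
`integral_mul_dalembertian_eq_neg_integral_innerDual` (Euclidean models) moved along the
transport (`dalembertian_transportCLE`, `innerDual_mvfderiv_transportCLE`,
`riemVolume_transportCLE`). [cite: Lee2018, Problem 2-23 (a)] -/
theorem integral_mul_dalembertian_riemVolume (hg : g.IsRiemannian) {u f : M → ℝ}
    (hu : ContMDiff I 𝓘(ℝ, ℝ) 1 u) (hf : ContMDiff I 𝓘(ℝ, ℝ) 2 f) :
    ∫ x, u x * g.dalembertian f x ∂g.riemVolume =
      -∫ x, g.innerDual x (mvfderiv I u x : TangentSpace I x →ₗ[ℝ] ℝ)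
        (mvfderiv I f x : TangentSpace I x →ₗ[ℝ] ℝ) ∂g.riemVolume := by
  set e : E ≃L[ℝ] EuclideanSpace ℝ (Fin (finrank ℝ E)) := toEuclidean with he
  haveI hB : (I.transContinuousLinearEquiv e).Boundaryless := boundaryless_transCLE I e
  haveI := (g.transportCLE e).hasLeviCivita
  have hg' : (g.transportCLE e).IsRiemannian := isRiemannian_transportCLE e hg
  have hu' : ContMDiff (I.transContinuousLinearEquiv e) 𝓘(ℝ, ℝ) 1 u :=
    (ContinuousLinearEquiv.contMDiff_transContinuousLinearEquiv_left e).2 hu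
  have hf' : ContMDiff (I.transContinuousLinearEquiv e) 𝓘(ℝ, ℝ) 2 f :=
    (ContinuousLinearEquiv.contMDiff_transContinuousLinearEquiv_left e).2 hf
  have hΔ : ∀ x, (g.transportCLE e).dalembertian f x = g.dalembertian f x := fun x ↦
    dalembertian_transportCLE g e (hf x)
  have hI : ∀ x, (g.transportCLE e).innerDual x
      (mvfderiv (I.transContinuousLinearEquiv e) u x :
        TangentSpace (I.transContinuousLinearEquiv e) x →ₗ[ℝ] ℝ)
      (mvfderiv (I.transContinuousLinearEquiv e) f x :
        TangentSpace (I.transContinuousLinearEquiv e) x →ₗ[ℝ] ℝ) =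
      g.innerDual x (mvfderiv I u x : TangentSpace I x →ₗ[ℝ] ℝ)
        (mvfderiv I f x : TangentSpace I x →ₗ[ℝ] ℝ) := fun x ↦
    innerDual_mvfderiv_transportCLE g e u f x
  have hV : (g.transportCLE e).riemVolume = g.riemVolume := riemVolume_transportCLE e hg
  haveI := (PseudoRiemannianMetric.ofRiemannian
    ((g.transportCLE e).toContMDiffRiemannianMetric hg')).hasLeviCivita
  have h0 := integral_mul_dalembertian_eq_neg_integral_innerDual
    ((g.transportCLE e).toContMDiffRiemannianMetric hg') hu' hf'
  rw [← PseudoRiemannianMetric.riemVolume_eq hg'] at h0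
  calc ∫ x, u x * g.dalembertian f x ∂g.riemVolume
      = ∫ x, u x * (g.transportCLE e).dalembertian f x ∂(g.transportCLE e).riemVolume := by
        rw [hV]
        exact integral_congr_ae (Eventually.of_forall fun x ↦
          congrArg (fun t ↦ u x * t) (hΔ x).symm)
    _ = -∫ x, (g.transportCLE e).innerDual x
          (mvfderiv (I.transContinuousLinearEquiv e) u x :
            TangentSpace (I.transContinuousLinearEquiv e) x →ₗ[ℝ] ℝ)
          (mvfderiv (I.transContinuousLinearEquiv e) f x :
            TangentSpace (I.transContinuousLinearEquiv e) x →ₗ[ℝ] ℝ)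
          ∂(g.transportCLE e).riemVolume := h0
    _ = -∫ x, g.innerDual x (mvfderiv I u x : TangentSpace I x →ₗ[ℝ] ℝ)
          (mvfderiv I f x : TangentSpace I x →ₗ[ℝ] ℝ) ∂g.riemVolume := by
        rw [hV]
        congr 1
        exact integral_congr_ae (Eventually.of_forall fun x ↦ hI x)

end Green

/-! ### §4, sharpness: `𝒲(g, f + log Θ, 1) = log Θ`, hence `μ(g, 1) ≤ log Θ`, on a closed shrinker -/

section Sharpness

variable {E : Type*} [NormedAddCommGroup E] [NormedSpace ℝ E] [FiniteDimensional ℝ E]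
  {H : Type*} [TopologicalSpace H] {I : ModelWithCorners ℝ E H} [I.Boundaryless]
  {M : Type*} [TopologicalSpace M] [ChartedSpace H M] [IsManifold I ∞ M]
  [CompactSpace M] [T3Space M] [MeasurableSpace M] [BorelSpace M]
  {g : PseudoRiemannianMetric I ∞ E (TangentSpace I : M → Type _)} {f : M → ℝ}

omit [I.Boundaryless] in
/-- **Thm. 1.1 (i) on a closed manifold**: `e^{-f}` is integrable for `dV_g` (continuous, finite
volume). [cite: CarrilloNi2009, Thm. 1.1 (i)] -/
theorem integrable_exp_neg_of_contMDiff (hf : ContMDiff I 𝓘(ℝ, ℝ) ∞ f) :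
    Integrable (fun x ↦ Real.exp (-f x)) g.riemVolume :=
  g.integrable_of_continuous (Real.continuous_exp.comp hf.continuous.neg)

omit [I.Boundaryless] [CompactSpace M] [FiniteDimensional ℝ E] [IsManifold I ∞ M] [T3Space M]
  [MeasurableSpace M] [BorelSpace M] in
/-- The density `(4πτ)^{-n/2} e^{-ψ}` of a smooth `ψ` is smooth. [folklore] -/
theorem contMDiff_entropyDensity' (n : ℕ) {ψ : M → ℝ} (hψ : ContMDiff I 𝓘(ℝ, ℝ) ∞ ψ) (τ : ℝ) :
    ContMDiff I 𝓘(ℝ, ℝ) ∞ (entropyDensity n ψ τ) := by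
  have h : ContMDiff I 𝓘(ℝ, ℝ) ∞ fun x ↦ Real.exp (-ψ x) := Real.contDiff_exp.comp_contMDiff hψ.neg
  exact contMDiff_const.mul h

variable [g.HasLeviCivita]

/-- **§4, sharpness on a closed gradient shrinker** ("`u = e^{-f}/(4πτ)^{n/2}` is the minimizer
for Perelman's `μ(g, τ)`"; Cor. 4.1 `μ(g, 1) = −μ_s` with `−μ_s = log Θ` in the tree's
normalisation): for `g` Riemannian on a closed manifold (any model space) and `f` smooth with
`Ric + Hess f = g/2`, `R + |∇f|² = f`, the compatible shift `f + log Θ` of the potential has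
`𝒲(g, f + log Θ, 1) = log Θ`: its `𝒲`-integrand is `(2f + log Θ − n) u`,
`u = Θ⁻¹(4π)^{-n/2} e^{-f}` of unit mass, and `∫ (2f − n) e^{-f} dV = 2 ∫ Δ(e^{-f}) dV = 0`
(`dalembertian_exp_neg`, `integral_dalembertian_riemVolume_eq_zero`).
[cite: CarrilloNi2009, §4 (sharpness) and Cor. 4.1 (closed case)] -/
theorem _root_.Literature.Geometry.Lorentzian.PseudoRiemannianMetric.IsNormalisedShrinker.wEntropy_add_log_shrinkerDensity
    [Nonempty M] (hg : g.IsRiemannian) (hf : ContMDiff I 𝓘(ℝ, ℝ) ∞ f)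
    (h : g.IsNormalisedShrinker f 1) :
    g.wEntropy g.leviCivita (fun y ↦ f y + Real.log (g.shrinkerDensity f 1).toReal) 1 =
      Real.log (g.shrinkerDensity f 1).toReal := by
  have hint : Integrable (fun x ↦ Real.exp (-f x)) g.riemVolume := integrable_exp_neg_of_contMDiff hf
  have hcompat := isEntropyCompatible_add_log_shrinkerDensity hg hint
  rw [PseudoRiemannianMetric.isEntropyCompatible_iff] at hcompat
  set Θ : ℝ := (g.shrinkerDensity f 1).toReal with hΘdef
  have hΘpos : 0 < Θ := g.shrinkerDensity_toReal_pos hg hint one_pos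
  have hΘ : Θ = (4 * Real.pi) ^ (-(finrank ℝ E : ℝ) / 2) * ∫ x, Real.exp (-f x) ∂g.riemVolume := by
    rw [hΘdef, g.shrinkerDensity_toReal hint one_pos, mul_one]
  have hdens := fun x ↦ entropyDensity_add_log_of_pos (f := f) hΘpos (finrank ℝ E) x
  have hu : Integrable (entropyDensity (finrank ℝ E) (fun y ↦ f y + Real.log Θ) 1) g.riemVolume := by
    by_contra hni
    rw [integral_undef hni] at hcompat
    exact zero_ne_one hcompat
  have hfint : Integrable (fun x ↦ f x * Real.exp (-f x)) g.riemVolume :=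
    g.integrable_of_continuous (hf.continuous.mul (Real.continuous_exp.comp hf.continuous.neg))
  have hI : Integrable (fun x ↦ (2 * f x - finrank ℝ E) * Real.exp (-f x)) g.riemVolume :=
    ((hfint.const_mul 2).sub (hint.const_mul (finrank ℝ E : ℝ))).congr
      (Eventually.of_forall fun x ↦ by simp only [Pi.sub_apply]; ring)
  -- Green: `∫ (2f − n) e^{-f} dV = 2 ∫ Δ(e^{-f}) dV = 0`
  have hdiv : ∫ x, (2 * f x - finrank ℝ E) * Real.exp (-f x) ∂g.riemVolume = 0 := by
    have h2 : ContMDiff I 𝓘(ℝ, ℝ) 2 (fun y ↦ Real.exp (-f y)) :=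
      ((Real.contDiff_exp.comp contDiff_neg).comp_contMDiff hf).of_le ENat.LEInfty.out
    have h0 := integral_dalembertian_riemVolume_eq_zero g hg h2
    simp_rw [h.dalembertian_exp_neg hf] at h0
    have h3 : ∀ x, (2 * f x - finrank ℝ E) * Real.exp (-f x) =
        2 * ((f x - (finrank ℝ E : ℝ) / 2) * Real.exp (-f x)) := fun x ↦ by ring
    simp_rw [h3]
    rw [integral_const_mul, h0, mul_zero]
  rw [PseudoRiemannianMetric.wEntropy_def]
  have hpt : ∀ x, (1 * (g.scalarCurvatureWith g.leviCivita x +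
      g.gradSq (fun y ↦ f y + Real.log Θ) x) + (f x + Real.log Θ) - finrank ℝ E) *
        entropyDensity (finrank ℝ E) (fun y ↦ f y + Real.log Θ) 1 x =
      Θ⁻¹ * (4 * Real.pi) ^ (-(finrank ℝ E : ℝ) / 2) * ((2 * f x - finrank ℝ E) * Real.exp (-f x)) +
        Real.log Θ * entropyDensity (finrank ℝ E) (fun y ↦ f y + Real.log Θ) 1 x := by
    intro x
    rw [PseudoRiemannianMetric.scalarCurvatureWith_leviCivita,
      g.gradSq_add_const _ (hf.mdifferentiableAt (by norm_num)), h.2 x, hdens x]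
    ring
  simp_rw [hpt]
  rw [integral_add (hI.const_mul _) (hu.const_mul _), integral_const_mul, integral_const_mul, hdiv,
    hcompat]
  ring

/-- **`μ(g, 1) ≤ log Θ` on a closed gradient shrinker — the first half of Carrillo–Ni's
Cor. 4.1 for the tree's `μ`, unconditionally and for any model space**
(`Θ = (4π)^{-n/2} ∫ e^{-f} dV = g.shrinkerDensity f 1`): the compatible shift `f + log Θ` is
admissible (Thm. 1.1 (i)) and `𝒲(g, f + log Θ, 1) = log Θ` (sharpness), so `muEntropy_le`
applies. [cite: CarrilloNi2009, Thm. 1.1 (i), §4 and Cor. 4.1 (closed case)] -/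
theorem _root_.Literature.Geometry.Lorentzian.PseudoRiemannianMetric.IsNormalisedShrinker.muEntropy_le_log_shrinkerDensity
    [Nonempty M] (hg : g.IsRiemannian) (hf : ContMDiff I 𝓘(ℝ, ℝ) ∞ f)
    (h : g.IsNormalisedShrinker f 1) :
    g.muEntropy g.leviCivita 1 ≤ ((Real.log (g.shrinkerDensity f 1).toReal : ℝ) : EReal) := by
  have hcompat :=
    isEntropyCompatible_add_log_shrinkerDensity hg (integrable_exp_neg_of_contMDiff (g := g) hf)
  have hsmooth : ContMDiff I 𝓘(ℝ, ℝ) ∞ fun y ↦ f y + Real.log (g.shrinkerDensity f 1).toReal :=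
    hf.add contMDiff_const
  have hle := PseudoRiemannianMetric.muEntropy_le (cov := g.leviCivita) hsmooth hcompat
  rwa [h.wEntropy_add_log_shrinkerDensity hg hf] at hle

end Sharpness

/-! ### §4, the inequality: `log Θ ≤ μ(g, 1)` from the Bakry–Émery logarithmic Sobolev inequality -/

section LSI

variable {E : Type*} [NormedAddCommGroup E] [NormedSpace ℝ E] [FiniteDimensional ℝ E]
  {H : Type*} [TopologicalSpace H] {I : ModelWithCorners ℝ E H} [I.Boundaryless]
  {M : Type*} [TopologicalSpace M] [ChartedSpace H M] [IsManifold I ∞ M]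
  [CompactSpace M] [T3Space M] [MeasurableSpace M] [BorelSpace M]
  {g : PseudoRiemannianMetric I ∞ E (TangentSpace I : M → Type _)} {f : M → ℝ}

omit [I.Boundaryless] [CompactSpace M] [T3Space M] [MeasurableSpace M] [BorelSpace M] in
/-- **`|∇(u − v)|² = |∇u|² − 2 g⁻¹(du, dv) + |∇v|²`** at a point where `u, v` are differentiable
(bilinearity and symmetry of the inverse metric). [folklore] -/
theorem _root_.Literature.Geometry.Lorentzian.PseudoRiemannianMetric.gradSq_sub
    (g : PseudoRiemannianMetric I ∞ E (TangentSpace I : M → Type _)) {u v : M → ℝ} {x : M}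
    (hu : MDifferentiableAt I 𝓘(ℝ, ℝ) u x) (hv : MDifferentiableAt I 𝓘(ℝ, ℝ) v x) :
    g.gradSq (u - v) x = g.gradSq u x
      - 2 * g.innerDual x (mvfderiv I u x : TangentSpace I x →ₗ[ℝ] ℝ)
          (mvfderiv I v x : TangentSpace I x →ₗ[ℝ] ℝ) + g.gradSq v x := by
  have hc := g.innerDual_comm x (mvfderiv I u x : TangentSpace I x →ₗ[ℝ] ℝ)
    (mvfderiv I v x : TangentSpace I x →ₗ[ℝ] ℝ)
  simp only [PseudoRiemannianMetric.innerDual] at hc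
  rw [PseudoRiemannianMetric.gradSq, mvfderiv_sub hu hv, ContinuousLinearMap.toLinearMap_sub]
  simp only [PseudoRiemannianMetric.gradSq, PseudoRiemannianMetric.innerDual, map_sub,
    LinearMap.sub_apply]
  linarith

omit [I.Boundaryless] [CompactSpace M] [T3Space M] [MeasurableSpace M] [BorelSpace M]
  [FiniteDimensional ℝ E] [IsManifold I ∞ M] in
/-- **The differential of the density**: `d u = −u dψ` for `u = (4πτ)^{-n/2} e^{-ψ}`.
[folklore] -/
theorem mvfderiv_entropyDensity_apply (n : ℕ) {ψ : M → ℝ} (τ : ℝ) {x : M}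
    (hψ : MDifferentiableAt I 𝓘(ℝ, ℝ) ψ x) (v : TangentSpace I x) :
    mvfderiv I (entropyDensity n ψ τ) x v = -entropyDensity n ψ τ x * mvfderiv I ψ x v := by
  have h1 : HasDerivAt (fun t : ℝ ↦ Real.exp (-t)) (-Real.exp (-ψ x)) (ψ x) := by
    simpa using (hasDerivAt_neg (ψ x)).exp
  have hh := h1.const_mul ((4 * Real.pi * τ) ^ (-(n : ℝ) / 2))
  have h2 := mvfderiv_real_comp_apply (I := I) hh hψ v
  have e1 : entropyDensity n ψ τ =
      (fun t : ℝ ↦ (4 * Real.pi * τ) ^ (-(n : ℝ) / 2) * Real.exp (-t)) ∘ ψ := rfl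
  rw [e1, h2, Function.comp_apply]
  ring

variable [g.HasLeviCivita]

/-- **`log Θ ≤ μ(g, 1)` on a closed gradient shrinker from the logarithmic Sobolev inequality of
its Gaussian measure** — Carrillo–Ni's derivation of Thm. 1.1 (ii) / Cor. 4.1 from the
Bakry–Émery inequality (§4, p. 9 of the arXiv text), for any model space. Hypotheses: `g`
Riemannian on a closed manifold, `f` smooth with `Ric + Hess f = g/2`, `R + |∇f|² = f`; write
`Θ = (4π)^{-n/2}∫ e^{-f} dV` and `u₀ = (4π)^{-n/2} e^{-(f + log Θ)}` (a probability density,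
Thm. 1.1 (i)). ASSUMED (hypothesis `hLSI`, the Bakry–Émery inequality `H ≤ I` of the
`C(1/2, ∞)` measure `dm = u₀ dV`, in smooth form): for every smooth `φ` with `∫ e^φ dm = 1`,
`∫ φ e^φ dm ≤ ∫ |∇φ|² e^φ dm`. CONCLUSION: `log Θ ≤ 𝒲(g, ψ, 1)` for every smooth compatible
`ψ`, i.e. `log Θ ≤ μ(g, 1)`. Proof (loc. cit.): with `φ = f + log Θ − ψ` one has `e^φ u₀ = u`,
the density of `ψ`; `|∇φ|² = |∇f|² − 2g⁻¹(df, dψ) + |∇ψ|²`, and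
`∫ g⁻¹(df, dψ) u = −∫ g⁻¹(du, df) = ∫ u Δf` (Green's first identity,
`integral_mul_dalembertian_riemVolume`), so the right-hand side is
`∫ (|∇f|² − 2Δf + |∇ψ|²) u = ∫ (S + f − n + |∇ψ|²) u` by (2.3), while the left-hand side is
`∫ (f + log Θ − ψ) u`; the difference of the two sides is `𝒲(g, ψ, 1) − log Θ ≥ 0`.
[cite: CarrilloNi2009, §4 (proof of Thm. 1.1 (ii)) and Cor. 4.1] -/
theorem _root_.Literature.Geometry.Lorentzian.PseudoRiemannianMetric.IsNormalisedShrinker.log_shrinkerDensity_le_muEntropy_of_logSobolev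
    [Nonempty M] (hg : g.IsRiemannian) (hf : ContMDiff I 𝓘(ℝ, ℝ) ∞ f)
    (h : g.IsNormalisedShrinker f 1)
    (hLSI : ∀ φ : M → ℝ, ContMDiff I 𝓘(ℝ, ℝ) ∞ φ →
      ∫ x, Real.exp (φ x) * entropyDensity (finrank ℝ E)
          (fun y ↦ f y + Real.log (g.shrinkerDensity f 1).toReal) 1 x ∂g.riemVolume = 1 →
      ∫ x, φ x * (Real.exp (φ x) * entropyDensity (finrank ℝ E)
          (fun y ↦ f y + Real.log (g.shrinkerDensity f 1).toReal) 1 x) ∂g.riemVolume ≤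
        ∫ x, g.gradSq φ x * (Real.exp (φ x) * entropyDensity (finrank ℝ E)
          (fun y ↦ f y + Real.log (g.shrinkerDensity f 1).toReal) 1 x) ∂g.riemVolume) :
    ((Real.log (g.shrinkerDensity f 1).toReal : ℝ) : EReal) ≤ g.muEntropy g.leviCivita 1 := by
  rw [PseudoRiemannianMetric.le_muEntropy_iff]
  intro ψ hψ hψc
  rw [PseudoRiemannianMetric.isEntropyCompatible_iff] at hψc
  refine EReal.coe_le_coe_iff.2 ?_
  have hint : Integrable (fun x ↦ Real.exp (-f x)) g.riemVolume := integrable_exp_neg_of_contMDiff hf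
  have hΘpos : 0 < (g.shrinkerDensity f 1).toReal := g.shrinkerDensity_toReal_pos hg hint one_pos
  set c : ℝ := Real.log (g.shrinkerDensity f 1).toReal with hcdef
  -- the test function `φ = f + c − ψ` and the key identity `e^φ u₀ = u`
  set φ : M → ℝ := fun y ↦ f y + c - ψ y with hφdef
  have hφ : ContMDiff I 𝓘(ℝ, ℝ) ∞ φ := (hf.add contMDiff_const).sub hψ
  have key : ∀ x, Real.exp (φ x) * entropyDensity (finrank ℝ E) (fun y ↦ f y + c) 1 x =
      entropyDensity (finrank ℝ E) ψ 1 x := by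
    intro x
    have hx : f x + c - ψ x + -(f x + c) = -ψ x := by ring
    simp only [hφdef, entropyDensity_apply]
    rw [mul_left_comm, ← Real.exp_add, hx]
  have hmass : ∫ x, Real.exp (φ x) * entropyDensity (finrank ℝ E) (fun y ↦ f y + c) 1 x
      ∂g.riemVolume = 1 := by
    simp_rw [key]
    exact hψc
  have hL := hLSI φ hφ hmass
  simp_rw [key] at hL
  -- differentiability / continuity
  have hf1 : ContMDiff I 𝓘(ℝ, ℝ) 1 f := hf.of_le (by norm_num)
  have hf2 : ContMDiff I 𝓘(ℝ, ℝ) 2 f := hf.of_le (WithTop.coe_le_coe.mpr le_top)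
  have hψ1 : ContMDiff I 𝓘(ℝ, ℝ) 1 ψ := hψ.of_le (by norm_num)
  have hφ1 : ContMDiff I 𝓘(ℝ, ℝ) 1 φ := hφ.of_le (by norm_num)
  have hus : ContMDiff I 𝓘(ℝ, ℝ) ∞ (entropyDensity (finrank ℝ E) ψ 1) :=
    contMDiff_entropyDensity' _ hψ 1
  have hu1 : ContMDiff I 𝓘(ℝ, ℝ) 1 (entropyDensity (finrank ℝ E) ψ 1) := hus.of_le (by norm_num)
  have huc : Continuous (entropyDensity (finrank ℝ E) ψ 1) := hus.continuous
  have hSc : Continuous g.scalarCurvature := (contMDiff_scalarCurvature g).continuous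
  have hΔc : Continuous (g.dalembertian f) := continuous_dalembertian g hf2
  have hGφ : Continuous (g.gradSq φ) := continuous_innerDual_mvfderiv g hφ1 hφ1
  have hGψ : Continuous (g.gradSq ψ) := continuous_innerDual_mvfderiv g hψ1 hψ1
  have hIc : Continuous fun x ↦ g.innerDual x (mvfderiv I f x : TangentSpace I x →ₗ[ℝ] ℝ)
      (mvfderiv I ψ x : TangentSpace I x →ₗ[ℝ] ℝ) := continuous_innerDual_mvfderiv g hf1 hψ1
  -- pointwise: `|∇φ|² = |∇f|² − 2 g⁻¹(df, dψ) + |∇ψ|²`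
  have hgrad : ∀ x, g.gradSq φ x = g.gradSq f x
      - 2 * g.innerDual x (mvfderiv I f x : TangentSpace I x →ₗ[ℝ] ℝ)
          (mvfderiv I ψ x : TangentSpace I x →ₗ[ℝ] ℝ) + g.gradSq ψ x := by
    intro x
    have hfd : MDifferentiableAt I 𝓘(ℝ, ℝ) f x := hf.mdifferentiableAt (by norm_num)
    have hψd : MDifferentiableAt I 𝓘(ℝ, ℝ) ψ x := hψ.mdifferentiableAt (by norm_num)
    have hφeq : φ = fun y ↦ (f - ψ) y + c := by
      funext y
      simp only [hφdef, Pi.sub_apply]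
      ring
    rw [hφeq, g.gradSq_add_const c (hfd.sub hψd), g.gradSq_sub hfd hψd]
  -- the cross term by Green's first identity: `∫ g⁻¹(df, dψ) u = ∫ u Δf`
  have hcross : ∫ x, g.innerDual x (mvfderiv I f x : TangentSpace I x →ₗ[ℝ] ℝ)
      (mvfderiv I ψ x : TangentSpace I x →ₗ[ℝ] ℝ) * entropyDensity (finrank ℝ E) ψ 1 x
        ∂g.riemVolume =
      ∫ x, entropyDensity (finrank ℝ E) ψ 1 x * g.dalembertian f x ∂g.riemVolume := by
    rw [integral_mul_dalembertian_riemVolume g hg hu1 hf2, ← integral_neg]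
    refine integral_congr_ae (Eventually.of_forall fun x ↦ ?_)
    have hψd : MDifferentiableAt I 𝓘(ℝ, ℝ) ψ x := hψ.mdifferentiableAt (by norm_num)
    have hdu : (mvfderiv I (entropyDensity (finrank ℝ E) ψ 1) x : TangentSpace I x →ₗ[ℝ] ℝ) =
        (-entropyDensity (finrank ℝ E) ψ 1 x) • (mvfderiv I ψ x : TangentSpace I x →ₗ[ℝ] ℝ) := by
      ext v
      simp only [ContinuousLinearMap.coe_coe, LinearMap.smul_apply, smul_eq_mul]
      exact mvfderiv_entropyDensity_apply _ 1 hψd v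
    have hc := g.innerDual_comm x (mvfderiv I f x : TangentSpace I x →ₗ[ℝ] ℝ)
      (mvfderiv I ψ x : TangentSpace I x →ₗ[ℝ] ℝ)
    change _ = -(g.innerDual x _ _)
    rw [hdu]
    simp only [PseudoRiemannianMetric.innerDual, LinearMap.smul_apply, smul_eq_mul] at hc ⊢
    rw [hc]
    ring
  -- pointwise rearrangement using (2.3): `|∇f|² − 2Δf = S + f − n`
  have hpt : ∀ x, g.gradSq φ x * entropyDensity (finrank ℝ E) ψ 1 x
      - φ x * entropyDensity (finrank ℝ E) ψ 1 x =
      (1 * (g.scalarCurvatureWith g.leviCivita x + g.gradSq ψ x) + ψ x - finrank ℝ E) *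
          entropyDensity (finrank ℝ E) ψ 1 x
        - c * entropyDensity (finrank ℝ E) ψ 1 x
        - 2 * (g.innerDual x (mvfderiv I f x : TangentSpace I x →ₗ[ℝ] ℝ)
            (mvfderiv I ψ x : TangentSpace I x →ₗ[ℝ] ℝ) * entropyDensity (finrank ℝ E) ψ 1 x
          - entropyDensity (finrank ℝ E) ψ 1 x * g.dalembertian f x) := by
    intro x
    have h23 := h.two_mul_dalembertian_identity x
    rw [hgrad x, PseudoRiemannianMetric.scalarCurvatureWith_leviCivita]
    simp only [hφdef]
    linear_combination (-entropyDensity (finrank ℝ E) ψ 1 x) * h23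
  -- integrability of everything in sight (continuous functions on a compact manifold)
  have iW : Integrable (fun x ↦ (1 * (g.scalarCurvatureWith g.leviCivita x + g.gradSq ψ x) + ψ x
      - finrank ℝ E) * entropyDensity (finrank ℝ E) ψ 1 x) g.riemVolume := by
    refine g.integrable_of_continuous ?_
    simp_rw [PseudoRiemannianMetric.scalarCurvatureWith_leviCivita]
    exact ((((continuous_const.mul (hSc.add hGψ)).add hψ.continuous).sub continuous_const).mul huc)
  have iu : Integrable (entropyDensity (finrank ℝ E) ψ 1) g.riemVolume := g.integrable_of_continuous huc
  have iI : Integrable (fun x ↦ g.innerDual x (mvfderiv I f x : TangentSpace I x →ₗ[ℝ] ℝ)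
      (mvfderiv I ψ x : TangentSpace I x →ₗ[ℝ] ℝ) * entropyDensity (finrank ℝ E) ψ 1 x)
      g.riemVolume := g.integrable_of_continuous (hIc.mul huc)
  have iΔ : Integrable (fun x ↦ entropyDensity (finrank ℝ E) ψ 1 x * g.dalembertian f x)
      g.riemVolume := g.integrable_of_continuous (huc.mul hΔc)
  have iG : Integrable (fun x ↦ g.gradSq φ x * entropyDensity (finrank ℝ E) ψ 1 x) g.riemVolume :=
    g.integrable_of_continuous (hGφ.mul huc)
  have iφ : Integrable (fun x ↦ φ x * entropyDensity (finrank ℝ E) ψ 1 x) g.riemVolume :=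
    g.integrable_of_continuous (hφ.continuous.mul huc)
  -- integrate the rearrangement
  have hW : g.wEntropy g.leviCivita ψ 1 =
      ∫ x, (1 * (g.scalarCurvatureWith g.leviCivita x + g.gradSq ψ x) + ψ x - finrank ℝ E) *
        entropyDensity (finrank ℝ E) ψ 1 x ∂g.riemVolume := g.wEntropy_def g.leviCivita ψ 1
  have s1 : ∫ x, g.gradSq φ x * entropyDensity (finrank ℝ E) ψ 1 x ∂g.riemVolume
      - ∫ x, φ x * entropyDensity (finrank ℝ E) ψ 1 x ∂g.riemVolume =
      ∫ x, (g.gradSq φ x * entropyDensity (finrank ℝ E) ψ 1 x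
        - φ x * entropyDensity (finrank ℝ E) ψ 1 x) ∂g.riemVolume := (integral_sub iG iφ).symm
  have s2 : ∫ x, (g.gradSq φ x * entropyDensity (finrank ℝ E) ψ 1 x
        - φ x * entropyDensity (finrank ℝ E) ψ 1 x) ∂g.riemVolume =
      ∫ x, ((1 * (g.scalarCurvatureWith g.leviCivita x + g.gradSq ψ x) + ψ x - finrank ℝ E) *
          entropyDensity (finrank ℝ E) ψ 1 x
        - c * entropyDensity (finrank ℝ E) ψ 1 x
        - 2 * (g.innerDual x (mvfderiv I f x : TangentSpace I x →ₗ[ℝ] ℝ)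
            (mvfderiv I ψ x : TangentSpace I x →ₗ[ℝ] ℝ) * entropyDensity (finrank ℝ E) ψ 1 x
          - entropyDensity (finrank ℝ E) ψ 1 x * g.dalembertian f x)) ∂g.riemVolume :=
    integral_congr_ae (Eventually.of_forall hpt)
  have e1 : ∫ x, ((1 * (g.scalarCurvatureWith g.leviCivita x + g.gradSq ψ x) + ψ x - finrank ℝ E) *
          entropyDensity (finrank ℝ E) ψ 1 x
        - c * entropyDensity (finrank ℝ E) ψ 1 x
        - 2 * (g.innerDual x (mvfderiv I f x : TangentSpace I x →ₗ[ℝ] ℝ)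
            (mvfderiv I ψ x : TangentSpace I x →ₗ[ℝ] ℝ) * entropyDensity (finrank ℝ E) ψ 1 x
          - entropyDensity (finrank ℝ E) ψ 1 x * g.dalembertian f x)) ∂g.riemVolume =
      ∫ x, ((1 * (g.scalarCurvatureWith g.leviCivita x + g.gradSq ψ x) + ψ x - finrank ℝ E) *
          entropyDensity (finrank ℝ E) ψ 1 x
        - c * entropyDensity (finrank ℝ E) ψ 1 x) ∂g.riemVolume
      - ∫ x, 2 * (g.innerDual x (mvfderiv I f x : TangentSpace I x →ₗ[ℝ] ℝ)
            (mvfderiv I ψ x : TangentSpace I x →ₗ[ℝ] ℝ) * entropyDensity (finrank ℝ E) ψ 1 x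
          - entropyDensity (finrank ℝ E) ψ 1 x * g.dalembertian f x) ∂g.riemVolume :=
    integral_sub (iW.sub' (iu.const_mul c)) ((iI.sub' iΔ).const_mul 2)
  have e2 : ∫ x, ((1 * (g.scalarCurvatureWith g.leviCivita x + g.gradSq ψ x) + ψ x - finrank ℝ E) *
          entropyDensity (finrank ℝ E) ψ 1 x
        - c * entropyDensity (finrank ℝ E) ψ 1 x) ∂g.riemVolume =
      ∫ x, (1 * (g.scalarCurvatureWith g.leviCivita x + g.gradSq ψ x) + ψ x - finrank ℝ E) *
          entropyDensity (finrank ℝ E) ψ 1 x ∂g.riemVolume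
      - ∫ x, c * entropyDensity (finrank ℝ E) ψ 1 x ∂g.riemVolume :=
    integral_sub iW (iu.const_mul c)
  have e3 : ∫ x, c * entropyDensity (finrank ℝ E) ψ 1 x ∂g.riemVolume =
      c * ∫ x, entropyDensity (finrank ℝ E) ψ 1 x ∂g.riemVolume := integral_const_mul c _
  rw [hψc, mul_one] at e3
  have e4 : ∫ x, 2 * (g.innerDual x (mvfderiv I f x : TangentSpace I x →ₗ[ℝ] ℝ)
            (mvfderiv I ψ x : TangentSpace I x →ₗ[ℝ] ℝ) * entropyDensity (finrank ℝ E) ψ 1 x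
          - entropyDensity (finrank ℝ E) ψ 1 x * g.dalembertian f x) ∂g.riemVolume =
      2 * ∫ x, (g.innerDual x (mvfderiv I f x : TangentSpace I x →ₗ[ℝ] ℝ)
            (mvfderiv I ψ x : TangentSpace I x →ₗ[ℝ] ℝ) * entropyDensity (finrank ℝ E) ψ 1 x
          - entropyDensity (finrank ℝ E) ψ 1 x * g.dalembertian f x) ∂g.riemVolume :=
    integral_const_mul 2 _
  have e5 : ∫ x, (g.innerDual x (mvfderiv I f x : TangentSpace I x →ₗ[ℝ] ℝ)
            (mvfderiv I ψ x : TangentSpace I x →ₗ[ℝ] ℝ) * entropyDensity (finrank ℝ E) ψ 1 x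
          - entropyDensity (finrank ℝ E) ψ 1 x * g.dalembertian f x) ∂g.riemVolume =
      ∫ x, g.innerDual x (mvfderiv I f x : TangentSpace I x →ₗ[ℝ] ℝ)
            (mvfderiv I ψ x : TangentSpace I x →ₗ[ℝ] ℝ) * entropyDensity (finrank ℝ E) ψ 1 x
          ∂g.riemVolume
      - ∫ x, entropyDensity (finrank ℝ E) ψ 1 x * g.dalembertian f x ∂g.riemVolume :=
    integral_sub iI iΔ
  linarith [hL, s1, s2, e1, e2, e3, e4, e5, hcross, hW]

/-- **Carrillo–Ni's Cor. 4.1 (closed case) from the Bakry–Émery theorem.** The named fact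
`carrilloNi_muEntropy_eq_log_shrinkerDensity` (`μ(g, 1) = log Θ` on every closed connected
normalised gradient shrinker, any model space) follows from the logarithmic Sobolev inequality of
Bakry–Émery on closed weighted manifolds (Carrillo–Ni's Thm. 3.1, after Villani and
Bakry–Émery), taken here as the hypothesis `hBE` in smooth form: for `g` Riemannian on a closed
connected manifold, `V` smooth with `Ric + Hess V ≥ K g`, `K > 0`, and `∫ e^{-V} dV = 1`, every
smooth `φ` with `∫ e^φ e^{-V} dV = 1` satisfies
`∫ φ e^φ e^{-V} dV ≤ (1/2K) ∫ |∇φ|² e^φ e^{-V} dV` (`H_V ≤ I_V/(2K)`). Proof: `μ ≤ log Θ` is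
`muEntropy_le_log_shrinkerDensity`; for `log Θ ≤ μ` apply
`log_shrinkerDensity_le_muEntropy_of_logSobolev` with the inequality supplied by `hBE` for
`V = f + log Θ + (n/2) log 4π` (`e^{-V} = u₀`), `K = 1/2`: `Hess V = Hess f`
(`hessian_add_const`) and `Ric + Hess f = g/2`. What remains for
`carrilloNi_muEntropy_eq_log_shrinkerDensity_holds` is exactly `hBE`.
[cite: CarrilloNi2009, Thm. 3.1, §4 and Cor. 4.1] -/
theorem carrilloNi_muEntropy_eq_log_shrinkerDensity_of_bakryEmery
    (hBE : ∀ (E : Type u) [NormedAddCommGroup E] [NormedSpace ℝ E] [FiniteDimensional ℝ E]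
      (H : Type u) [TopologicalSpace H] (I : ModelWithCorners ℝ E H) [I.Boundaryless]
      (M : Type u) [TopologicalSpace M] [ChartedSpace H M] [IsManifold I ∞ M] [T3Space M]
      [MeasurableSpace M] [BorelSpace M] [CompactSpace M] [ConnectedSpace M]
      (g : PseudoRiemannianMetric I ∞ E (TangentSpace I : M → Type _)) [g.HasLeviCivita]
      (V : M → ℝ) (K : ℝ), g.IsRiemannian → ContMDiff I 𝓘(ℝ, ℝ) ∞ V → 0 < K →
      (∀ (x : M) (X : TangentSpace I x), K * g.val x X X ≤ g.ricci x X X + g.hessian V x X X) →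
      ∫ x, Real.exp (-V x) ∂g.riemVolume = 1 →
      ∀ φ : M → ℝ, ContMDiff I 𝓘(ℝ, ℝ) ∞ φ →
        ∫ x, Real.exp (φ x) * Real.exp (-V x) ∂g.riemVolume = 1 →
        ∫ x, φ x * (Real.exp (φ x) * Real.exp (-V x)) ∂g.riemVolume ≤
          1 / (2 * K) * ∫ x, g.gradSq φ x * (Real.exp (φ x) * Real.exp (-V x)) ∂g.riemVolume) :
    carrilloNi_muEntropy_eq_log_shrinkerDensity.{u} := by
  intro E _ _ _ H _ I _ M _ _ _ _ _ _ _ _ g _ f hg hf h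
  apply le_antisymm (h.muEntropy_le_log_shrinkerDensity hg hf)
  refine h.log_shrinkerDensity_le_muEntropy_of_logSobolev hg hf fun φ hφ hmass ↦ ?_
  have hint : Integrable (fun x ↦ Real.exp (-f x)) g.riemVolume := integrable_exp_neg_of_contMDiff hf
  have hΘpos : 0 < (g.shrinkerDensity f 1).toReal := g.shrinkerDensity_toReal_pos hg hint one_pos
  -- the potential `V = f + log Θ + (n/2) log 4π`, `e^{-V} = u₀`
  set C : ℝ := Real.log (g.shrinkerDensity f 1).toReal +
    (finrank ℝ E : ℝ) / 2 * Real.log (4 * Real.pi) with hCdef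
  set V : M → ℝ := fun y ↦ f y + C with hVdef
  have hVu : ∀ x, Real.exp (-V x) =
      entropyDensity (finrank ℝ E) (fun y ↦ f y + Real.log (g.shrinkerDensity f 1).toReal) 1 x := by
    intro x
    rw [entropyDensity_apply, mul_one, Real.rpow_def_of_pos (by positivity), ← Real.exp_add]
    congr 1
    simp only [hVdef, hCdef]
    ring
  have hV : ContMDiff I 𝓘(ℝ, ℝ) ∞ V := hf.add contMDiff_const
  have hRic : ∀ (x : M) (X : TangentSpace I x),
      1 / 2 * g.val x X X ≤ g.ricci x X X + g.hessian V x X X := by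
    intro x X
    have hfx : ContMDiffAt I 𝓘(ℝ, ℝ) 2 f x := (hf.of_le (WithTop.coe_le_coe.mpr le_top)).contMDiffAt
    rw [show g.hessian V x X X = g.hessian f x X X from g.hessian_add_const C hfx X X, h.1 x X X]
    norm_num
  have hmassV : ∫ x, Real.exp (-V x) ∂g.riemVolume = 1 := by
    simp_rw [hVu]
    exact isEntropyCompatible_add_log_shrinkerDensity hg hint
  have hmass' : ∫ x, Real.exp (φ x) * Real.exp (-V x) ∂g.riemVolume = 1 := by
    simp_rw [hVu]
    exact hmass
  have key := hBE E H I M g V (1 / 2) hg hV one_half_pos hRic hmassV φ hφ hmass'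
  simp_rw [hVu] at key
  rw [show (1 : ℝ) / (2 * (1 / 2)) = 1 by norm_num, one_mul] at key
  exact key

end LSI

end Literature.Geometry.Riemannian

end
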